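import Literature.Computability.AlgebraicComplexity.DeterminantUniversalityBCS
import Literature.Computability.AlgebraicComplexity.PermanentUniversality
import HarnessLib

/-!
# Universality of the determinant with the expression-size bound — discharge of
# `BCS1997_thm_21_27_det`

D-0014 keeps `Literature/` sorry-free by stating cited results as named facts. This file proves
the named fact `Literature.Computability.AlgebraicComplexity.BCS1997_thm_21_27_det` of
`DeterminantUniversalityBCS.lean` — Bürgisser–Clausen–Shokrollahi 1997, Thm. (21.27),
DETERMINANT half (Valiant 1979, Thm. 1: universality of the determinant for formulas, with the
size bound): every arithmetic expression `φ` of size `u = E(φ)` over `I = k ∪ {X_i}` is a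
projection of the generic determinant `DET_{2u+2}`:

* `Literature.Computability.AlgebraicComplexity.BCS1997_thm_21_27_det_holds :
    BCS1997_thm_21_27_det k` (every field `k`; in fact the construction works over every
  commutative ring, `ArithExpr.isDetProjection_eval`).

## The printed proof and the one formalised

BCS prove the permanent and the determinant statements of Thm. (21.27) by one induction along
the construction of `φ` (pp. 555–557 of the book; "the universality of PER is shown in a
similar way"): leaves get a `2 × 2` matrix, products a block triangular matrix, sums are merged
by Lemma (21.28). The tree's `PermanentUniversality.lean` formalises that induction as the
*weighted transitive DAG* of `φ` on `{0, …, 2u+2}` (`ArithExpr.dagWeights`: leaves = a path of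
length two, products = series composition, sums = parallel composition) together with the
identity `per (hess n w) = pathSum w n` (`permanent_hess`) for the lower Hessenberg matrix
`hess n w` of a DAG (unit SUBdiagonal, weight `w r (c+1)` at `(r, c)` for `r ≤ c`, zero below
the subdiagonal), and the path-sum identity `pathSum (wval φ.dagWeights) (2u+2) = val(φ)`
(`ArithExpr.pathSum_dagWeights`, property (A) of the printed proof).

For the DETERMINANT one only has to control the signs: the permutations contributing to
`det (hess n w)` are the products of the interval cycles `(a a+1 … b)`; such a cycle has sign
`(-1)^{b-a}` and uses exactly `b - a` subdiagonal entries. Hence, replacing the unit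
subdiagonal by `-1` (`hessNeg n w`), every term of the Leibniz expansion acquires the sign
twice and `det (hessNeg n w) = pathSum w n` (`det_hessNeg`; proved, like `permanent_hess`, by
the Laplace expansion along the last row, `Matrix.det_succ_row`, whose two nonzero entries are
the subdiagonal `-1` — with cofactor sign `(-1)^{(n-1)+(n-2)} = -1` — and the corner
`w (n-1) n` — with cofactor sign `+1`). Reading the DAG of `φ` through `hessNeg` instead of
`hess` gives a `(2u+2) × (2u+2)` matrix whose entries are `-1`, `0`, constants of `φ` or
variables of `φ`, i.e. a Valiant projection of `DET_{2u+2}` (`IsDetProjection`,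
`ArithExpr.isDetProjection_eval`), with determinant `val(φ)`. This is Valiant's 1979
construction (Valiant, §2, treats permanent and determinant simultaneously by this sign
bookkeeping); the size `2u + 2` is BCS's (B).

Credit. The subdiagonal twist and the Laplace proof of `det_hessNeg` were first written in the
tree in the crux sketch `Summits/ValiantsHypothesis/ValiantsHypothesis/Cruxes/PdcQpOfVp/
IdeateK2Sketch.lean` (idea `hessenberg-subdiagonal-twist`, 2026-08-17), which is not importable
from `Literature/`; the present file is its Literature-side version, so that the named fact is
discharged where it is stated.

## Contents

* `hessNeg n w`, `det_hessNeg : det (hessNeg n w) = pathSum w n` (every commutative ring).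
* `ArithExpr.toDetMatrix φ` — the `(2u+2) × (2u+2)` matrix over `I = k ∪ X` (entries
  `Sum.inl (-1)`, `Sum.inl 0`, or a DAG weight); `ArithExpr.map_toDetMatrix`;
  `entryDet A := det (A.map entryVal)`, `isProjection_entryDet_detPoly`,
  `ArithExpr.entryDet_toDetMatrix : entryDet φ.toDetMatrix = φ.eval`,
  `ArithExpr.isDetProjection_eval : IsDetProjection φ.eval (2 * φ.size + 2)` (comm. rings).
* `BCS1997_thm_21_27_det_holds`.

## References

* P. Bürgisser, M. Clausen, M. A. Shokrollahi, *Algebraic Complexity Theory*, Grundlehren 315,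
  Springer 1997, §21.3, Thm. (21.27) p. 555 and its proof (properties (A)–(D), Lemma (21.28)),
  pp. 555–557 (held copy `book:burgisser1997-algebraic-complexity-theory`, PDF pp. 582–584).
  [BurgisserClausenShokrollahi1997]
* L. G. Valiant, *Completeness classes in algebra*, Proc. 11th STOC (1979), 249–261, §2, Thm. 1
  (universality of the determinant for formulas). [Valiant1979]
-/

noncomputable section

open MvPolynomial Matrix Finset

namespace Literature.Computability.AlgebraicComplexity

universe u v

/-! ### Lower Hessenberg matrices with subdiagonal `-1`: the determinant is the path sum -/

section HessNeg

variable {R : Type*} [CommRing R]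

/-- The lower Hessenberg matrix of a weighted transitive DAG on `{0, …, n}` with subdiagonal
`-1`: entry `(r, c)` is `-1` on the subdiagonal `r = c + 1`, the weight `w r (c+1)` of the edge
`r → c + 1` for `r ≤ c`, and `0` below the subdiagonal (Valiant 1979, §2: the determinant twin
of the tree's `hess n w`, whose PERMANENT is the path sum; BCS 1997, proof of Thm. (21.27),
normal form (C), "the universality of PER is shown in a similar way").
[cite: BurgisserClausenShokrollahi1997, Thm. (21.27) (C)] -/
def hessNeg (n : ℕ) (w : ℕ → ℕ → R) : Matrix (Fin n) (Fin n) R := fun r c =>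
  if r.val = c.val + 1 then -1 else if r.val ≤ c.val then w r.val (c.val + 1) else 0

/-- **The determinant of a lower Hessenberg matrix with subdiagonal `-1` is the path sum of its
DAG**: `det (hessNeg n w) = P_w(n)`. Each interval cycle `(a a+1 … b)` has sign `(-1)^{b-a}`
and uses exactly `b - a` subdiagonal entries `-1`, so the signs cancel termwise against
`per (hess n w) = P_w(n)` (`permanent_hess`). Proof by the Laplace expansion along the last row
(`Matrix.det_succ_row`): its only entries are the subdiagonal `-1` (cofactor sign `-1`; the minor
is the matrix of the DAG in which the vertex `n - 1` is skipped, i.e. the edges into `n` are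
redirected into `n - 1`) and the corner `w (n-1) n` (cofactor sign `+1`; minor
`hessNeg (n-1) w`) — the determinant reading of BCS 1997, Lemma (21.28).
[cite: BurgisserClausenShokrollahi1997, Lemma (21.28)] -/
theorem det_hessNeg (n : ℕ) (w : ℕ → ℕ → R) : (hessNeg n w).det = pathSum w n := by
  induction n generalizing w with
  | zero => rw [pathSum_zero]; exact Matrix.det_isEmpty
  | succ m ih =>
    rw [Matrix.det_succ_row _ (Fin.last m), Fin.sum_univ_castSucc]
    have hlast : hessNeg (m + 1) w (Fin.last m) (Fin.last m) = w m (m + 1) := by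
      simp [hessNeg]
    have hminor_last : (hessNeg (m + 1) w).submatrix (Fin.last m).succAbove (Fin.last m).succAbove
        = hessNeg m w := by
      ext r c
      simp [hessNeg, Fin.succAbove_last]
    have hsign_last : ((-1 : R) ^ ((Fin.last m : ℕ) + (Fin.last m : ℕ))) = 1 := by
      rw [Fin.val_last, ← two_mul, pow_mul, neg_one_sq, one_pow]
    rw [hlast, hminor_last, ih w, hsign_last, one_mul]
    cases m with
    | zero =>
      rw [pathSum_one, pathSum_zero]
      simp
    | succ m' =>
      -- the `castSucc` part of the last row has a single nonzero entry `-1`, at column `m'`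
      rw [Finset.sum_eq_single (Fin.last m')]
      · have hentry :
            hessNeg (m' + 2) w (Fin.last (m' + 1)) (Fin.castSucc (Fin.last m')) = -1 := by
          simp [hessNeg]
        have hsign : ((-1 : R) ^ ((Fin.last (m' + 1) : ℕ) + (Fin.castSucc (Fin.last m') : ℕ)))
            = -1 := by
          rw [Fin.val_last, Fin.val_castSucc, Fin.val_last,
            show m' + 1 + m' = 2 * m' + 1 by ring, pow_succ, pow_mul, neg_one_sq, one_pow, one_mul]
        set w' : ℕ → ℕ → R := fun a c => if c = m' + 1 then w a (m' + 2) else w a c with hw'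
        have hminor : (hessNeg (m' + 2) w).submatrix (Fin.last (m' + 1)).succAbove
            (Fin.castSucc (Fin.last m')).succAbove = hessNeg (m' + 1) w' := by
          ext r c
          rcases Fin.eq_castSucc_or_eq_last c with ⟨c', rfl⟩ | rfl
          · have h1 : (Fin.castSucc (Fin.last m')).succAbove (Fin.castSucc c') =
                Fin.castSucc (Fin.castSucc c') :=
              Fin.succAbove_of_castSucc_lt _ _
                (Fin.castSucc_lt_castSucc_iff.2 (Fin.castSucc_lt_last c'))
            have hc' := c'.isLt
            simp [hessNeg, h1, Fin.succAbove_last, hw', Nat.ne_of_lt hc']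
          · have h1 : (Fin.castSucc (Fin.last m')).succAbove (Fin.last m') = Fin.last (m' + 1) := by
              rw [Fin.succAbove_of_le_castSucc _ _ le_rfl, Fin.succ_last]
            have hr := r.isLt
            simp [hessNeg, h1, Fin.succAbove_last, hw']
            rw [if_neg (by omega), if_neg (by omega), if_pos (by omega)]
        have key : pathSum w' (m' + 1) + w (m' + 1) (m' + 2) * pathSum w (m' + 1) =
            pathSum w (m' + 2) := by
          rw [pathSum_succ, pathSum_succ w (m' + 1),
            Finset.sum_range_succ (fun a => pathSum w a * w a (m' + 2))]
          congr 1
          · refine sum_congr rfl fun a ha => ?_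
            rw [mem_range] at ha
            rw [pathSum_congr (w := w') (w' := w)
              (fun a' c hc => by rw [hw']; dsimp only; rw [if_neg (by omega)])]
            simp [hw']
          · ring
        rw [hentry, hsign, hminor, ih w', ← key]
        ring
      · intro j _ hj
        have : hessNeg (m' + 2) w (Fin.last (m' + 1)) (Fin.castSucc j) = 0 := by
          have hj' : j.val ≠ m' := fun h => hj (Fin.ext (by rw [Fin.val_last]; exact h))
          have hjlt := j.isLt
          have e1 : ¬ (m' + 1 = j.val + 1) := by omega
          have e2 : ¬ (m' + 1 ≤ j.val) := by omega
          simp only [hessNeg, Fin.val_last, Fin.val_castSucc, e1, e2, if_false]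
        rw [this, mul_zero, zero_mul]
      · intro h; exact absurd (mem_univ _) h

/-- `P_w(1) = w(0,1) = det (hessNeg 1 w)` — the `1 × 1` case, checked directly. [folklore] -/
example (w : ℕ → ℕ → R) : (hessNeg 1 w).det = w 0 1 := by
  rw [det_hessNeg, pathSum_one]

/-- `det (hessNeg 2 w) = w(0,2) + w(0,1) w(1,2)` — the `2 × 2` case, checked directly against
`Matrix.det_fin_two`. [folklore] -/
example (w : ℕ → ℕ → R) : (hessNeg 2 w).det = w 0 2 + w 0 1 * w 1 2 := by
  rw [Matrix.det_fin_two]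
  simp [hessNeg]
  ring

end HessNeg

/-! ### The determinant matrix of an expression (BCS 1997, proof of Thm. (21.27)) -/

section ExprDet

variable {k : Type u} [CommRing k] {σ : Type v}

/-- The determinant `det(A) ∈ k[X]` of a square matrix `A` over `I = k ∪ {X_i}` (BCS 1997,
§21.3, matrices over `k ∪ {X_i}`, (21.12)). [cite: BurgisserClausenShokrollahi1997, (21.12)] -/
def entryDet {N : ℕ} (A : Matrix (Fin N) (Fin N) (k ⊕ σ)) : MvPolynomial σ k :=
  (A.map entryVal).det

/-- **`det(A)` is a projection of `DET_N`** for a matrix `A` over `k ∪ {X_i}`: substitute the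
entry `a_{ij} ∈ k ∪ {X_i}` for the variable `X_{ij}` of the generic determinant
(BCS 1997, (21.12)(1) and §21.3; Valiant 1979, §2). [cite: BurgisserClausenShokrollahi1997, (21.12)] -/
theorem isProjection_entryDet_detPoly {N : ℕ} (A : Matrix (Fin N) (Fin N) (k ⊕ σ)) :
    IsProjection (entryDet A) (detPoly (Fin N) k) := by
  refine ⟨fun ij => (A.map entryVal) ij.1 ij.2, fun ij => ?_, ?_⟩
  · show (∃ j, entryVal (A ij.1 ij.2) = X j) ∨ ∃ c, entryVal (A ij.1 ij.2) = C c
    rcases A ij.1 ij.2 with c | i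
    · exact Or.inr ⟨c, rfl⟩
    · exact Or.inl ⟨i, rfl⟩
  · unfold entryDet
    rw [detPoly, AlgHom.map_det, Matrix.mvPolynomialX_mapMatrix_aeval]

namespace ArithExpr

/-- The `(2u+2) × (2u+2)` DETERMINANT matrix of an expression `φ` of size `u` over `I = k ∪ X`
(BCS 1997, Thm. (21.27), determinant half; Valiant 1979, §2): the lower Hessenberg matrix of
the DAG `φ.dagWeights` with subdiagonal `-1` — entry `(r, c)` is `-1` if `r = c + 1`, the weight
of the edge `r → c + 1` if `r ≤ c`, and `0` below the subdiagonal.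
[cite: BurgisserClausenShokrollahi1997, Thm. (21.27)] -/
def toDetMatrix (φ : ArithExpr k σ) :
    Matrix (Fin (2 * φ.size + 2)) (Fin (2 * φ.size + 2)) (k ⊕ σ) := fun r c =>
  if r.val = c.val + 1 then Sum.inl (-1)
  else if r.val ≤ c.val then φ.dagWeights r.val (c.val + 1) else Sum.inl 0

/-- The determinant matrix of an expression, read in `k[X]`, is the `-1`-subdiagonal Hessenberg
matrix of the polynomial weights of its DAG. [cite: BurgisserClausenShokrollahi1997, Thm. (21.27)] -/
theorem map_toDetMatrix (φ : ArithExpr k σ) :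
    φ.toDetMatrix.map entryVal = hessNeg (2 * φ.size + 2) (wval φ.dagWeights) := by
  ext r c
  simp only [Matrix.map_apply, toDetMatrix, hessNeg, wval]
  split_ifs <;> simp

/-- **Properties (A), (B), determinant half**: `det μ⁻(φ) = val(φ)` for the `(2u+2) × (2u+2)`
determinant matrix of an expression of size `u` (`det_hessNeg` + the path-sum identity
`pathSum_dagWeights` of the tree's permanent-side proof; BCS 1997, Thm. (21.27)).
[cite: BurgisserClausenShokrollahi1997, Thm. (21.27)] -/
theorem entryDet_toDetMatrix (φ : ArithExpr k σ) : entryDet φ.toDetMatrix = φ.eval := by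
  rw [entryDet, map_toDetMatrix, det_hessNeg, pathSum_dagWeights]

/-- **Valiant 1979, Thm. 1 / BCS 1997, Thm. (21.27), determinant half, over every commutative
ring**: the value of an expression of size `u` is a projection of `DET_{2u+2}`.
[cite: BurgisserClausenShokrollahi1997, Thm. (21.27)] -/
theorem isDetProjection_eval (φ : ArithExpr k σ) : IsDetProjection φ.eval (2 * φ.size + 2) := by
  rw [IsDetProjection, ← entryDet_toDetMatrix]
  exact isProjection_entryDet_detPoly _

end ArithExpr

end ExprDet

end Literature.Computability.AlgebraicComplexity

/-! ### Discharge of the named fact -/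

namespace Literature.Computability.AlgebraicComplexity

universe u'

/-- **Discharge of `BCS1997_thm_21_27_det`** (BCS 1997, Thm. (21.27), determinant half;
Valiant 1979, Thm. 1): every expression `φ` of size `u` over `k ∪ X` is a projection of the
generic determinant `DET_{2u+2}` — namely the determinant of `φ.toDetMatrix`, the
`-1`-subdiagonal Hessenberg matrix of the DAG of `φ`. [cite: BurgisserClausenShokrollahi1997, Thm. (21.27), p. 555] -/
theorem BCS1997_thm_21_27_det_holds : ∀ (k : Type u') [Field k], BCS1997_thm_21_27_det k :=
  fun _ _ _ φ => φ.isDetProjection_eval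

end Literature.Computability.AlgebraicComplexity
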